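import Literature.MathematicalPhysics.QuantumFieldTheory.Balaban1983to89.B2Prop31MinimizerRegionsNonzero

/-!
# `Balaban1983to89.B2Prop31MinimizerRegionsN` — [Balaban1982Higgs2] Proposition 3.1 (3.26) p. 589 for the family with the PRINTED minimizers
(3.3), the PRINTED restrictions (2.55) and the CONSTRUCTED regions of (2.7)–(2.8), with the (2.44) cut-off radius at step `k` equal to the
`n`-COLLAR radius `ρ_k^{(n)} = n·r(L^{k−1}ε)/L − 2M − 2` and Lemma 2.3 read over `(Λ_{n−1}^{(k−1)})′` — `n = 3` is p319405's ruled radius (c) over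
`(Λ₂^{(k−1)})′` (Lemma 2.3's STATED domain), `n = 2` reads Lemma 2.3 over `(Λ₁^{(k−1)})′` and HOSTS THE PRINTED CUT-OFFS `θ_k` (whose slice
surrounds `B^{k−1}(Λ₂^{(k−1)})`, p. 567), `n = 1` reads it over `(Λ₀^{(k−1)})′` (every application inside the core of the (2.55) window)

statement-level skeleton of published theorems with citation tags; proofs where landed; nothing here is a claim about the Yang–Mills mass gap

CITATION HEADER.  T. Bałaban, *(Higgs)₂,₃ quantum fields in a finite volume. II. An upper bound*, Commun. Math. Phys. **86** (1982) 555–594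
[Balaban1982Higgs2] (PDF held `paper:balaban1982-cmp86-higgs23-ii`, journal page = PDF page + 554; pp. 558, 566–567, 570–571, 576–577, 583, 589
on the ×2 renders `run/shared/lean/pub/pub-balaban/b2b-balaban-ref1/pages/1982-cmp86-higgs23-II/…`); part I [Balaban1982Higgs1] (1.3) p. 604,
(1.20)/(1.22) p. 607, (2.15) p. 609.  Cell `lit-balaban` (HOME `run/shared/lean/pub/lit-balaban/`), Phase-2 proof seat **p23** gen 13 (unit
`lit-balaban-p23-g13`; TAKING line HOME/STATUS.md 2026-08-22T06:11Z; GAPS.md «ADDENDUM G-B2-12 (p23 gen 13)»).  SKELETON rows **B2.Prop3.1** (owner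
r02), **B2.Eq3.29**, **B2.Lem2.3**, **B2.Eq2.44**, **B2.Eq2.7** — CELLS ONLY, no head claims; second reader r14, referee ref-4.  USED BY NAME, NOTHING
RESTATED: p23 g13 `B2Prop31MinimizerRegions.{lemma23_thresholds_rad, towerRad, towerRad_eq, le_towerRad, towerRad_nonneg, L1Of}` (p319405),
`B2Prop31MinimizerRegionsNonzero.norm_cutMin_const_sub_lt_rad` (p320224), `B2Eq28RegionsCollars.{mem_regionRel_of_tdist_le_mul, prime_mono,
tdist_le_mul_tdist_blockOf_add_real}` (p318957), p23 g11/g12 `B2Prop31MinimizerFamily.{MinConsts, Lemma23Bounds, exists_lemma23Bounds}`,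
`B2Prop31MinimizerWitness.{thetaW, nested_thetaW, chargeW, thrQ_nonneg, kappaW, kappaW_nonneg}`, `B2Eq244Cutoff.{zeta244, …, le_rFn}`, the
typer's `B2Eq243RegionsTower.{towerRegion, towerRegion_eq, towerOf, towerOf_lam_of_lt, towerRegion_antitone}`, `B2Eq28RegionsConcrete.{near,
mem_near, subset_near}`, p15's `prime`/`mem_prime`, p23 g10 `B2Prop31PrintedRestrictions.{RMultiP, printedP31Fam, printed329Fam,
prop31Printed_thresholds, ineq329Printed_thresholds}`, r14 `B2Lemma23HiggsLattice.cutMin`, b2b's `B2.{Params, rFn, Prop31Printed, Ineq329Printed}`.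

WHY THIS FILE (GAPS.md G-B2-12 + its ADDENDUM by p23 g13, 2026-08-22T06:11Z).  Lemma 2.3 is STATED (p. 571) for `x ∈ Bᵏ(Λ₂^{(k−1)′})`, and the
cell's ruling (c) sized the cut-off radius to the THREE (2.8)-collars between `Λ₂^{(k−1)′}` and `(Λ₋₁^{(k−1)′})ᶜ` (p318957 `nbhd_radC`, p319405
`RegionsData.toRMultiMR` with `L2 := (Λ₂^{(k−1)})′`).  But print APPLIES Lemma 2.3 also on the `θ`-slices (p. 576: *"If x belongs to this slice,
then … applying Lemma 2.3, we have (2.97)"*; in §3 through the regularity of (3.2) on `Bᵏ(Λ_k)` = the cell's slice conjuncts (2.59)_{k+1}/(2.60)_{k+1}),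
and by p. 567 *"The function θ_k is … equal to 1 on B^{k−1}(Λ₂^{(k−1)}) and varies "smoothly" from 1 to 0 on a slice of thickness < M surrounding
B^{k−1}(Λ₂^{(k−1)})"* the slice of `θ_{k+1}` lies OUTSIDE `Bᵏ(Λ₂^{(k)})`, over `(Λ₁^{(k)})′ ∖ (Λ₂^{(k)})′` — one collar outside the stated domain, where
only TWO collars remain.  Hence p319405's family (hypothesis `slice_sub` over `(Λ₂)′`) hosts cut-offs whose slice lies INSIDE `B((Λ₂)′)`, not
print's literal `θ_k`.  THIS FILE removes that restriction by making the number of collars a parameter `n`: radius `ρ_k^{(n)} = n·r(L^{k−1}ε)/L −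
2M − 2`, Lemma-2.3 domain `L2 := (Λ_{n−1}^{(k−1)})′`, `R₀ = (L/n)(2/δ + 2M + 2)` (*"R enlarged, constants only"*, as in the ruling); `n = 2` hosts
print's `θ_k` (slice labels in `(Λ₁)′`), `n = 1` hosts any cut-off supported over `(Λ₀)′`; `n = 3` reproduces p319405.

WHAT IS PRINTED.  (3.3) p. 583; (2.44) p. 566; (2.7)–(2.8) p. 558; p. 558 *"Λ^{(*,′)}_{−1} the set of the points (the bonds, the blocks) in T₁
distant from Λ₀ less than r(ε)"*; (2.55) p. 570 (*"for x ∈ Λ₋₁^{(k−1)′}, b ⊂ Λ₋₁^{(k−1)′}"*); Lemma 2.3 p. 571; p. 567 (θ_k, quoted above); p. 576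
(2.95)–(2.97) (quoted above); Prop. 3.1 p. 589.

WHAT THIS MODULE PROVES (kernel-checked, 0 `sorry`, standard axioms; definitions with bodies: `radN`, `RMultiMRN` + `.A/.field/.toRMultiP/
.restrictedM`, `minP31FamN`, `min329FamN`, `dataTowerN`, `L2OfN`, `RegionsDataN` + `.toRMultiMRN`, `regionsDataWN`; no `Prop` facts).
 §1 `radN` + arithmetic: `radN_ge_mul_u` (`c₀(1 + log(Lᵏε)⁻¹) ≤ ρ_k^{(n)}` for `R ≥ (L/n)(c₀ + 2M + 2)`, `r ≥ 1`, `n ≥ 1`), `exp_neg_delta_radN_le`,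
    `six_le_radN`, `R_pos_ofN`, `rFn_pos_ofN`; geometry: `mem_near_regionRel_of_tdist_le_gen` (`x ∈ Λ_{n−1}`, `|x − y| ≤ n·m`, `m < r ⇒ y ∈ near Λ₀ r`
    — `n − 1` collars of p318957 + the *"additional thickness"*), `nbhd_towerRegionN` (block-label form), `radN_geom` (room condition for
    `n ≤ 2ML + 1`), **`nbhd_radN`**.
 §2 `RMultiMRN n` (radius `ρ^{(n)}`), `restricted_toRMultiP` (`R ≥ (L/n)(2/δ + 2M + 2)`); §3 `minP31FamN`/`min329FamN`, **`prop31Printed_minimizersN`**,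
    **`ineq329Printed_minimizersN`** (`n ≥ 1`; `R₀ = (L/n)(2/δ + 2M + 2)`).
 §4 `dataTowerN`, `L2OfN` (`(Λ_{n−1}^{(l)})′` at level `l + 1`), `RegionsDataN` (data as in p319405's `RegionsData` with `1 ≤ n ≤ 3`, `R ≥ (L/n)(2M + 8)` and
    the `θ`-slice inclusion over `(Λ_{n−1})′`), **`RegionsDataN.toRMultiMRN`** (ζ-clauses, `L2_sub`, `nbhd` := `nbhd_radN`, `lam_sub` PROVED),
    `toRMultiMRN_L2_succ`; §5 `regionsDataWN`/`regionsDataWN_restrictedM` (K = 1, every `bad`); §6 `regionsDataWN_field_apply`,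
    **`regionsDataWN_field_ne_zero`** (field `≠ 0` over `(Λ_{n−1}^{(0)})′`, via p320224's radius-generic Lemma 2.3 with `q = 0`).
HONEST SCOPE.  (i)–(iii) as p319405 (integrated (2.55)₁; radius a READING — here a one-parameter family of readings, recorded in GAPS.md; `R₀` depends
on `(d, L, M, n, a, μ₀², ε₀)`).  (iv) With `n = 2` the printed `θ_k` of p. 567 satisfies `slice_sub` (its slice labels lie in `(Λ₁^{(k−1)})′`) — the
cut-offs `θ_k` themselves and their printed properties relative to the constructed tower are still DATA (their construction from the regions is
not formalized here).  (v) `n ≤ 3` in the constructor (room condition `n ≤ 2ML + 1` and `Λ₅ ⊂ Λ_{n−1}`); the carrier and §3 allow any `n ≥ 1`.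
(vi) Non-vacuity at `K = 1` only.  No row head changes (owner r02).  Nothing here is summit progress.
-/

noncomputable section

open Finset Real
open scoped BigOperators

namespace Literature.MathematicalPhysics.QuantumFieldTheory.Balaban1983to89.B2Prop31MinimizerRegionsN

open Literature.MathematicalPhysics.QuantumFieldTheory.Balaban1983to89.HiggsLattice
open Literature.MathematicalPhysics.QuantumFieldTheory.Balaban1983to89.HiggsAveraging
open Literature.MathematicalPhysics.QuantumFieldTheory.Balaban1983to89.B2Eq337ScalarIntegration
open Literature.MathematicalPhysics.QuantumFieldTheory.Balaban1983to89.B2Eq328ConcretePieces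
open Literature.MathematicalPhysics.QuantumFieldTheory.Balaban1983to89.B2Prop31ZeroFieldConcrete
open Literature.MathematicalPhysics.QuantumFieldTheory.Balaban1983to89.B2Eq324NestedRegions
open Literature.MathematicalPhysics.QuantumFieldTheory.Balaban1983to89.B2Eq32FieldRegularity
open Literature.MathematicalPhysics.QuantumFieldTheory.Balaban1983to89.B2Prop31Thresholds
open Literature.MathematicalPhysics.QuantumFieldTheory.Balaban1983to89.B2Prop31PrintedRestrictions
open Literature.MathematicalPhysics.QuantumFieldTheory.Balaban1983to89.B3MultiscaleFields (toSite ofSite zeroCharge toSite_ofSite)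
open Literature.MathematicalPhysics.QuantumFieldTheory.Balaban1983to89.B2Lemma23HiggsLattice (cutMin)
open Literature.MathematicalPhysics.QuantumFieldTheory.Balaban1983to89.B1Eq211ZeroFieldTorus (Shape)
open Literature.MathematicalPhysics.QuantumFieldTheory.Balaban1983to89.B2Prop31MinimizerFamily
  (MinConsts Lemma23Bounds exists_lemma23Bounds)
open Literature.MathematicalPhysics.QuantumFieldTheory.Balaban1983to89.B2Prop31MinimizerWitness
  (thetaW thetaW_one thetaW_of_ne nested_thetaW chargeW thrQ_nonneg kappaW kappaW_nonneg)
open Literature.MathematicalPhysics.QuantumFieldTheory.Balaban1983to89.B2Eq244Cutoff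
  (zeta244 abs_zeta244_le_one zeta244_supp zeta244_eq_one zeta244_lip le_rFn)
open Literature.MathematicalPhysics.QuantumFieldTheory.Balaban1983to89.B2Eq243RegionsTower
  (towerRegion towerRegion_eq towerOf towerOf_lam_of_lt towerRegion_antitone)
open Literature.MathematicalPhysics.QuantumFieldTheory.Balaban1983to89.B2Eq255RegionsWindow (regionRel)
open Literature.MathematicalPhysics.QuantumFieldTheory.Balaban1983to89.B2Eq28RegionsConcrete (near mem_near subset_near)
open Literature.MathematicalPhysics.QuantumFieldTheory.Balaban1983to89.B2Eq28RegionsCollars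
  (exists_tdist_split mem_regionRel_of_tdist_le_mul prime_mono tdist_le_mul_tdist_blockOf_add_real)
open Literature.MathematicalPhysics.QuantumFieldTheory.Balaban1983to89.B2Prop31MinimizerRegions
  (lemma23_thresholds_rad towerRad towerRad_eq le_towerRad towerRad_nonneg L1Of)
open Literature.MathematicalPhysics.QuantumFieldTheory.Balaban1983to89.B2Prop31MinimizerRegionsNonzero (norm_cutMin_const_sub_lt_rad)
open Literature.MathematicalPhysics.QuantumFieldTheory.Balaban1983to89.B1Ineq234LevelZero (tdist_triangle_real)
open B2Sect2BDensities (Nested)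

/-! ## §1 The `n`-collar radius, its largeness, and the `n`-collar geometry -/

/-- **The `n`-collar cut-off radius at step `k`**: `ρ_k^{(n)} = n·r(L^{k−1}ε)/L − 2M − 2` in lattice units of `T^{(k)}` (`r(s) = R(1 + log s⁻¹)^r`,
(2.7); `M` the large-block factor).  `n = 3` is the cell's reading (c) of G-B2-12; `n = 2`, `1` are the readings (c₂), (c₁) of its addendum.
[cite: Balaban1982Higgs2, (2.44) p.566, (2.7)–(2.8) p.558] -/
def radN (n : ℕ) (R r : ℝ) (P : HiggsLattice.Params) (k : ℕ) : ℝ :=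
  (n : ℝ) * B2.rFn R r (P.mesh (k - 1)) / (P.L : ℝ) - 2 * (P.M : ℝ) - 2

/-- `ρ_{l+1}^{(n)} = n·r(Lˡε)/L − 2M − 2` (definitional). [cite: Balaban1982Higgs2, (2.44) p.566] -/
theorem radN_succ (n : ℕ) (R r : ℝ) (P : HiggsLattice.Params) (l : ℕ) :
    radN n R r P (l + 1) = (n : ℝ) * B2.rFn R r (P.mesh l) / (P.L : ℝ) - 2 * (P.M : ℝ) - 2 := rfl

/-- **`ρ_k^{(n)}` is large when `R` is**: for `n ≥ 1`, `1 ≤ k`, `0 < Lᵏε ≤ 1`, `c₀ ≥ 0`, `r ≥ 1` and `R ≥ (L/n)(c₀ + 2M + 2)`: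
`c₀·(1 + log(Lᵏε)⁻¹) ≤ ρ_k^{(n)}`. [cite: Balaban1982Higgs2, (2.7) p.558, (2.44) p.566] -/
theorem radN_ge_mul_u {n : ℕ} (hn : 1 ≤ n) {R r c₀ : ℝ} {P : HiggsLattice.Params} {k : ℕ} (hk1 : 1 ≤ k) (hs1 : P.mesh k ≤ 1)
    (hc₀ : 0 ≤ c₀) (hR : (P.L : ℝ) / n * (c₀ + 2 * (P.M : ℝ) + 2) ≤ R) (hr : 1 ≤ r) :
    c₀ * (1 + Real.log (P.mesh k)⁻¹) ≤ radN n R r P k := by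
  obtain ⟨l, rfl⟩ : ∃ l, k = l + 1 := ⟨k - 1, by omega⟩
  rw [radN_succ]
  set s : ℝ := P.mesh (l + 1) with hs_def
  set s' : ℝ := P.mesh l with hs'_def
  have hs : 0 < s := P.mesh_pos (l + 1)
  have hs' : 0 < s' := P.mesh_pos l
  have hs's : s' ≤ s := mesh_le_mesh (Nat.le_succ l)
  have hL : (0 : ℝ) < (P.L : ℝ) := by exact_mod_cast P.hL
  have hnr : (1 : ℝ) ≤ (n : ℝ) := by exact_mod_cast hn
  have hnpos : (0 : ℝ) < (n : ℝ) := by linarith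
  have hM : (0 : ℝ) ≤ (P.M : ℝ) := Nat.cast_nonneg _
  have hR0 : 0 ≤ R := le_trans (by positivity) hR
  have hu : 1 ≤ 1 + Real.log s⁻¹ := one_le_u hs hs1
  have hu' : 1 + Real.log s⁻¹ ≤ 1 + Real.log s'⁻¹ := by
    have : Real.log s⁻¹ ≤ Real.log s'⁻¹ :=
      Real.log_le_log (inv_pos.mpr hs) ((inv_le_inv₀ hs hs').mpr hs's)
    linarith
  have hu'1 : 1 ≤ 1 + Real.log s'⁻¹ := hu.trans hu'
  have hrFn : R * (1 + Real.log s⁻¹) ≤ B2.rFn R r s' := by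
    unfold B2.rFn
    have h1 : 1 + Real.log s'⁻¹ ≤ (1 + Real.log s'⁻¹) ^ r := Real.self_le_rpow_of_one_le hu'1 hr
    calc R * (1 + Real.log s⁻¹) ≤ R * (1 + Real.log s'⁻¹) := mul_le_mul_of_nonneg_left hu' hR0
      _ ≤ R * (1 + Real.log s'⁻¹) ^ r := mul_le_mul_of_nonneg_left h1 hR0
  have hR' : (c₀ + 2 * (P.M : ℝ) + 2) * (1 + Real.log s⁻¹) ≤ (n : ℝ) * (R * (1 + Real.log s⁻¹)) / (P.L : ℝ) := by
    rw [le_div_iff₀ hL]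
    have h2 : (c₀ + 2 * (P.M : ℝ) + 2) * (P.L : ℝ) ≤ (n : ℝ) * R := by
      have := mul_le_mul_of_nonneg_left hR hnpos.le
      have h3 : (n : ℝ) * ((P.L : ℝ) / n * (c₀ + 2 * (P.M : ℝ) + 2)) = (c₀ + 2 * (P.M : ℝ) + 2) * (P.L : ℝ) := by
        field_simp
      linarith
    have h0 : 0 ≤ 1 + Real.log s⁻¹ := by linarith
    nlinarith
  have h4 : (n : ℝ) * (R * (1 + Real.log s⁻¹)) / (P.L : ℝ) ≤ (n : ℝ) * B2.rFn R r s' / (P.L : ℝ) :=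
    div_le_div_of_nonneg_right (mul_le_mul_of_nonneg_left hrFn hnpos.le) hL.le
  have h5 : (2 * (P.M : ℝ) + 2) * 1 ≤ (2 * (P.M : ℝ) + 2) * (1 + Real.log s⁻¹) :=
    mul_le_mul_of_nonneg_left hu (by positivity)
  nlinarith

/-- **The tail is absorbed**: `e^{−δρ_k^{(n)}/2} ≤ Lᵏε` for `R ≥ (L/n)(2/δ + 2M + 2)`, `r ≥ 1`, `n ≥ 1`, `0 < Lᵏε ≤ 1`, `k ≥ 1`.
[cite: Balaban1982Higgs2, (2.7) p.558, (2.44) p.566, Lemma 2.3 p.571] -/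
theorem exp_neg_delta_radN_le {n : ℕ} (hn : 1 ≤ n) {R r δ : ℝ} {P : HiggsLattice.Params} {k : ℕ} (hk1 : 1 ≤ k) (hs1 : P.mesh k ≤ 1)
    (hδ : 0 < δ) (hR : (P.L : ℝ) / n * (2 / δ + 2 * (P.M : ℝ) + 2) ≤ R) (hr : 1 ≤ r) :
    Real.exp (-(δ * (radN n R r P k / 2))) ≤ P.mesh k := by
  have hs : 0 < P.mesh k := P.mesh_pos k
  have h := radN_ge_mul_u hn hk1 hs1 (by positivity : (0 : ℝ) ≤ 2 / δ) hR hr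
  have hkey : 1 + Real.log (P.mesh k)⁻¹ ≤ δ * (radN n R r P k / 2) := by
    have h' := mul_le_mul_of_nonneg_left h hδ.le
    have h'' : δ * (2 / δ * (1 + Real.log (P.mesh k)⁻¹)) = 2 * (1 + Real.log (P.mesh k)⁻¹) := by field_simp
    linarith
  have hlog : Real.log (P.mesh k)⁻¹ = -Real.log (P.mesh k) := Real.log_inv _
  calc Real.exp (-(δ * (radN n R r P k / 2))) ≤ Real.exp (Real.log (P.mesh k)) := Real.exp_le_exp.2 (by linarith)
    _ = P.mesh k := Real.exp_log hs

/-- `ρ_k^{(n)} ≥ 6` for `R ≥ (L/n)(2M + 8)`, `r ≥ 1`, `n ≥ 1`, `0 < Lᵏε ≤ 1`, `k ≥ 1`. [cite: Balaban1982Higgs2, (2.44) p.566, (2.7) p.558] -/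
theorem six_le_radN {n : ℕ} (hn : 1 ≤ n) {R r : ℝ} {P : HiggsLattice.Params} {k : ℕ} (hk1 : 1 ≤ k) (hs1 : P.mesh k ≤ 1)
    (hR : (P.L : ℝ) / n * (2 * (P.M : ℝ) + 8) ≤ R) (hr : 1 ≤ r) : 6 ≤ radN n R r P k := by
  have hR' : (P.L : ℝ) / n * (6 + 2 * (P.M : ℝ) + 2) ≤ R := by
    have : (P.L : ℝ) / n * (6 + 2 * (P.M : ℝ) + 2) = (P.L : ℝ) / n * (2 * (P.M : ℝ) + 8) := by ring
    rw [this]; exact hR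
  have h : 6 * (1 + Real.log (P.mesh k)⁻¹) ≤ radN n R r P k := radN_ge_mul_u hn hk1 hs1 (by norm_num : (0 : ℝ) ≤ 6) hR' hr
  have hu : 1 ≤ 1 + Real.log (P.mesh k)⁻¹ := one_le_u (P.mesh_pos k) hs1
  nlinarith

/-- `R > 0` once `R ≥ (L/n)(2M + 8)` (`L, n ≥ 1`, `M ≥ 0`). [cite: Balaban1982Higgs2, (2.7) p.558] -/
theorem R_pos_ofN {n : ℕ} (hn : 1 ≤ n) {R : ℝ} {P : HiggsLattice.Params} (hR : (P.L : ℝ) / n * (2 * (P.M : ℝ) + 8) ≤ R) : 0 < R := by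
  have hL : (1 : ℝ) ≤ (P.L : ℝ) := by exact_mod_cast P.hL
  have hM : (0 : ℝ) ≤ (P.M : ℝ) := Nat.cast_nonneg _
  have hnpos : (0 : ℝ) < (n : ℝ) := by exact_mod_cast (lt_of_lt_of_le Nat.zero_lt_one hn)
  have h1 : 0 < (P.L : ℝ) / n := div_pos (by linarith) hnpos
  exact lt_of_lt_of_le (by nlinarith) hR

/-- `r(s) > 0` for `0 < s ≤ 1`, `r ≥ 0`, once `R ≥ (L/n)(2M + 8)`. [cite: Balaban1982Higgs2, (2.7) p.558] -/
theorem rFn_pos_ofN {n : ℕ} (hn : 1 ≤ n) {R r : ℝ} {P : HiggsLattice.Params} (hR : (P.L : ℝ) / n * (2 * (P.M : ℝ) + 8) ≤ R) (hr : 0 ≤ r)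
    {s : ℝ} (hs : 0 < s) (hs1 : s ≤ 1) : 0 < B2.rFn R r s :=
  lt_of_lt_of_le (R_pos_ofN hn hR) (le_rFn (R_pos_ofN hn hR).le hr hs hs1)

section Geometry

variable {P : HiggsLattice.Params}

/-- **`n − 1` collars and the *"additional thickness r(ε)"***: `x ∈ Λ_{n−1}`, `|x − y| ≤ n·m` with `m < r` (`n ≥ 1`) ⇒ `y ∈ near (Λ₀) r`
(split the geodesic at `(n − 1)·m`: the intermediate point lies in `Λ₀` by `n − 1` collars of (2.8), and `y` is `≤ m < r` further).
[cite: Balaban1982Higgs2, (2.8)–(2.9) p.558] -/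
theorem mem_near_regionRel_of_tdist_le_gen {k : ℕ} {W : Finset (HiggsLattice.Site P k)} {bad : Set (HiggsLattice.Site P k)} {r : ℝ}
    (hr : 0 ≤ r) {m : ℕ} (hm : (m : ℝ) < r) (n : ℕ) (hn : 1 ≤ n) {x y : HiggsLattice.Site P k}
    (hx : x ∈ regionRel W bad r (n - 1)) (hxy : HiggsLattice.Site.tdist x y ≤ n * m) : y ∈ near (regionRel W bad r 0) r := by
  obtain ⟨j, rfl⟩ : ∃ j, n = j + 1 := ⟨n - 1, by omega⟩
  rw [mem_near]
  cases j with
  | zero =>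
      -- `n = 1`: `x ∈ Λ₀` itself and `|x − y| ≤ m < r`
      refine ⟨x, by simpa using hx, ?_⟩
      have h1 : HiggsLattice.Site.tdist x y ≤ m := by simpa using hxy
      calc (HiggsLattice.Site.tdist x y : ℝ) ≤ m := by exact_mod_cast h1
        _ < r := hm
  | succ i =>
      -- `n = i + 2`: split the geodesic at `(i + 1)·m`; the intermediate point is in `Λ₀` by `i + 1` collars
      obtain ⟨z, hxz, hzy⟩ := exists_tdist_split x y ((i + 1) * m)
      have hx' : x ∈ regionRel W bad r (0 + i + 1) := by simpa [Nat.add_assoc] using hx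
      have hz : z ∈ regionRel W bad r 0 := mem_regionRel_of_tdist_le_mul hr hm.le i hx' hxz
      refine ⟨z, hz, ?_⟩
      have h1 : HiggsLattice.Site.tdist z y ≤ m := by
        have h2 : (i + 1 + 1) * m = (i + 1) * m + m := by ring
        omega
      calc (HiggsLattice.Site.tdist z y : ℝ) ≤ m := by exact_mod_cast h1
        _ < r := hm

/-- **The `nbhd` shape with `n` collars**, block-label form: `x₁ = blockOf x ∈ (Λ_{n−1})′`, `|x₁ − y′| ≤ ρ + 1`, `L(ρ + 2) − 1 ≤ n·m`, `m < r` ⇒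
`y′ ∈ (near Λ₀ r)′` (every point of `B(y′)` is within `L(ρ + 1) + L − 1 ≤ n·m` of `x ∈ Λ_{n−1}`). [cite: Balaban1982Higgs2, (2.8) p.558, Lemma 2.3 p.571] -/
theorem nbhd_towerRegionN {bad : (j : ℕ) → Set (HiggsLattice.Site P j)} {rr : ℕ → ℝ} (n : ℕ) (hn : 1 ≤ n) {l : ℕ} (hl : l < P.K)
    (hr : 0 ≤ rr l) {m : ℕ} (hm : (m : ℝ) < rr l) {ρ : ℝ} (hρ : (P.L : ℝ) * (ρ + 2) - 1 ≤ (n : ℝ) * (m : ℝ))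
    (x : HiggsLattice.Site P 0) (y' : HiggsLattice.Site P (l + 1)) (hx : blockIter (l + 1) x ∈ prime (towerRegion bad rr l (n - 1)))
    (hd : (HiggsLattice.Site.tdist (blockIter (l + 1) x) y' : ℝ) ≤ ρ + 1) :
    y' ∈ prime (near (towerRegion bad rr l 0) (rr l)) := by
  rw [towerRegion_eq] at hx ⊢
  rw [blockIter_succ_eq] at hx hd
  rw [mem_prime]
  intro y hy
  have hxΛ : blockIter l x ∈ regionRel _ (bad l) (rr l) (n - 1) := (mem_prime _ _).mp hx (blockIter l x) rfl
  have h1 := tdist_le_mul_tdist_blockOf_add_real hl (blockIter l x) y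
  rw [hy] at h1
  have hL0 : (0 : ℝ) ≤ (P.L : ℝ) := Nat.cast_nonneg _
  have h2 : (HiggsLattice.Site.tdist (blockIter l x) y : ℝ) ≤ (n : ℝ) * (m : ℝ) := by
    have := mul_le_mul_of_nonneg_left hd hL0
    linarith
  have h3 : HiggsLattice.Site.tdist (blockIter l x) y ≤ n * m := by exact_mod_cast h2
  exact mem_near_regionRel_of_tdist_le_gen hr hm n hn hxΛ h3

/-- **The room condition for `ρ^{(n)}`**: with `m = ⌈r(Lˡε)⌉ − 1` (`m < r(Lˡε)` for `r(Lˡε) > 0`), `L(ρ_{l+1}^{(n)} + 2) − 1 = n·r(Lˡε) − 2ML − 1 ≤ n·m`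
as soon as `n ≤ 2ML + 1`. [cite: Balaban1982Higgs2, (2.8) p.558, (2.44) p.566] -/
theorem radN_geom (n : ℕ) (R r : ℝ) (P : HiggsLattice.Params) (l : ℕ) (hpos : 0 < B2.rFn R r (P.mesh l))
    (hnML : (n : ℝ) ≤ 2 * (P.M : ℝ) * (P.L : ℝ) + 1) :
    ((⌈B2.rFn R r (P.mesh l)⌉₊ - 1 : ℕ) : ℝ) < B2.rFn R r (P.mesh l) ∧
      (P.L : ℝ) * (radN n R r P (l + 1) + 2) - 1 ≤ (n : ℝ) * (((⌈B2.rFn R r (P.mesh l)⌉₊ - 1 : ℕ) : ℝ)) := by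
  set s : ℝ := B2.rFn R r (P.mesh l) with hs
  have hceil1 : 1 ≤ ⌈s⌉₊ := Nat.one_le_iff_ne_zero.mpr (by
    intro h0
    have := Nat.ceil_eq_zero.mp h0
    linarith)
  have hcast : (((⌈s⌉₊ - 1 : ℕ) : ℝ)) = (⌈s⌉₊ : ℝ) - 1 := by rw [Nat.cast_sub hceil1, Nat.cast_one]
  have hlt : (⌈s⌉₊ : ℝ) < s + 1 := Nat.ceil_lt_add_one hpos.le
  have hge : s ≤ (⌈s⌉₊ : ℝ) := Nat.le_ceil s
  have hL1 : (1 : ℝ) ≤ (P.L : ℝ) := by exact_mod_cast P.hL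
  have hL0 : (0 : ℝ) < (P.L : ℝ) := by linarith
  have hn0 : (0 : ℝ) ≤ (n : ℝ) := Nat.cast_nonneg _
  refine ⟨by rw [hcast]; linarith, ?_⟩
  rw [hcast, radN_succ]
  have hexp : (P.L : ℝ) * ((n : ℝ) * s / (P.L : ℝ) - 2 * (P.M : ℝ) - 2 + 2) - 1 = (n : ℝ) * s - 2 * ((P.M : ℝ) * (P.L : ℝ)) - 1 := by
    field_simp
    ring
  rw [hexp]
  nlinarith

/-- **`nbhd` FOR THE CONSTRUCTED REGIONS AT THE `n`-COLLAR RADIUS** (`1 ≤ n ≤ 2ML + 1`): at level `k = l + 1 ≤ K` with `r(Lˡε) > 0`, if `x_k ∈ (Λ_{n−1}^{(l)})′`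
and `|x_k − y′| ≤ ρ_k^{(n)} + 1` then `y′ ∈ (near Λ₀^{(l)} r(Lˡε))′ ⊆ Λ₋₁^{(l)′}` — the `nbhd` hypothesis of Lemma 2.3 read over `(Λ_{n−1})′`.
[cite: Balaban1982Higgs2, Lemma 2.3 p.571, (2.44) p.566, (2.55) p.570, (2.8) p.558] -/
theorem nbhd_radN {bad : (j : ℕ) → Set (HiggsLattice.Site P j)} {R r : ℝ} {rr : ℕ → ℝ} (n : ℕ) (hn : 1 ≤ n)
    (hnML : (n : ℝ) ≤ 2 * (P.M : ℝ) * (P.L : ℝ) + 1) {l : ℕ} (hl : l + 1 ≤ P.K)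
    (hrr : rr l = B2.rFn R r (P.mesh l)) (hpos : 0 < B2.rFn R r (P.mesh l))
    (x : HiggsLattice.Site P 0) (y' : HiggsLattice.Site P (l + 1)) (hx : blockIter (l + 1) x ∈ prime (towerRegion bad rr l (n - 1)))
    (hd : (HiggsLattice.Site.tdist (blockIter (l + 1) x) y' : ℝ) ≤ radN n R r P (l + 1) + 1) :
    y' ∈ prime (near (towerRegion bad rr l 0) (rr l)) := by
  obtain ⟨hm, hρ⟩ := radN_geom n R r P l hpos hnML
  have hm' : ((⌈B2.rFn R r (P.mesh l)⌉₊ - 1 : ℕ) : ℝ) < rr l := by rw [hrr]; exact hm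
  have hpos' : 0 ≤ rr l := by rw [hrr]; exact hpos.le
  exact nbhd_towerRegionN n hn (by omega) hpos' hm' hρ x y' hx hd

end Geometry

/-! ## §2 The carrier with the (2.44) radius `ρ_k^{(n)}` -/

/-- **One instance of Proposition 3.1 with the (3.3) minimizers, the (2.55) restrictions and the (2.44) cut-offs at the `n`-collar radius**: the data
of `RMultiMK` (p315587) / `RMultiMR` (p319405) — lattice member of the torus sub-family with large-block factor `M`, steps `K`, stopping rule, tower of regions
`Λ₅⁽ᵏ⁾`, charge data, cut-offs `θ_k` with their printed properties, `A₀`, block vector fields `A_k`, configuration `Φ`, cut-offs `ζ^{(k)}` and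
regions `Λ₂ ⊆ Λ₁` per level with the `nbhd` / `Λ₅ ⊂ Λ₂` / slice hypotheses — with ONE change: the support / plateau / `nbhd` radii of level `k`
are `ρ_k^{(n)} = radN n`, `½ρ_k^{(n)}`, `ρ_k^{(n)} + 1` (`nbhd` for `1 ≤ k ≤ K`; `n = 3` is `RMultiMR`'s radius (c)). [cite: Balaban1982Higgs2, Prop. 3.1 p.589, (3.2)–(3.3) p.583, (2.44) p.566, (2.55) p.570, (2.7)–(2.8) p.558] -/
structure RMultiMRN (n : ℕ) (Q : B2.Params) (Γ : MinConsts) (M : ℕ) (m2 : ℝ) where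
  /-- the lattice family member (tori `T^{(k)}_{Lᵏε}`) -/
  P : HiggsLattice.Params
  hL : P.L = Q.L
  hd : P.d = Q.d
  /-- the large-block factor is the family's `M` (I p. 607) -/
  hM : P.M = M
  /-- the torus sub-family `M·L′_μ = Lᵐ`, `L` odd (r14's/p14's decay bounds) -/
  S : Shape P
  /-- number of real scalar-field components -/
  N : ℕ
  /-- number of renormalization steps -/
  K : ℕ
  hK : K ≤ P.K
  /-- the stopping rule `Lᴷε ≤ ε₀` (p. 582) -/
  hε₀ : P.mesh K ≤ Γ.ε₀
  /-- the tower of large-field regions `Λ₅⁽ᵏ⁾` -/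
  T : Tower P K
  C : ChargeData N
  /-- the model's coupling constant -/
  hCe : C.e = Γ.e
  /-- the cut-offs `θ_k` on the fine torus, with their printed properties (as in `RMultiP`) -/
  θ : ℕ → HiggsLattice.Site P 0 → ℝ
  θ_nested : Nested θ
  θ_range : ∀ m (z : HiggsLattice.Site P 0), 0 ≤ θ m z ∧ θ m z ≤ 1
  θ_one : ∀ k, 1 ≤ k → k ≤ K → ∀ z : HiggsLattice.Site P 0, T.lamAt (k - 1) z → θ k z = 1 ∧ ∀ ν, θ k (z.shift ν) = 1
  θ_zero : ∀ k, k + 2 ≤ K → ∀ z : HiggsLattice.Site P 0,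
    (θ (k + 2) z ≠ 0 ∨ ∃ ν, θ (k + 2) (z.shift ν) ≠ 0) → T.lamAt k z
  θ_above : ∀ m, K < m → ∀ z : HiggsLattice.Site P 0, θ m z = 0
  θ_lip : ∀ k (z : HiggsLattice.Site P 0) (ν : Fin P.d), |θ (k + 1) (z.shift ν) - θ (k + 1) z| ≤ Γ.cθ * ((P.L : ℝ) ^ k)⁻¹
  /-- `A₀` of (3.2) -/
  A₀ : HiggsLattice.VecField P 0
  /-- the block vector fields `A_k` on `T⁽ᵏ⁾` -/
  Ac : (k : ℕ) → HiggsLattice.VecField P k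
  /-- the configuration `Φ` of (3.24) -/
  Φ : Cfg T.regions N
  /-- the cut-offs `ζ^{(k)}(x, y′)` of (2.44), `y′` a block label of `T⁽ᵏ⁾` (only `1 ≤ k ≤ K` matter) -/
  ζ : (k : ℕ) → HiggsLattice.Site P 0 → HiggsLattice.Site P k → ℝ
  ζ_abs : ∀ k, 1 ≤ k → k ≤ K → ∀ x y', |ζ k x y'| ≤ 1
  /-- support radius `ρ_k^{(n)}` -/
  ζ_supp : ∀ k, 1 ≤ k → k ≤ K → ∀ x y', ζ k x y' ≠ 0 →
    (HiggsLattice.Site.tdist (blockIter k x) y' : ℝ) ≤ radN n Q.R Q.r P k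
  /-- plateau radius `½ρ_k^{(n)}` -/
  ζ_one : ∀ k, 1 ≤ k → k ≤ K → ∀ x y',
    (HiggsLattice.Site.tdist (blockIter k x) y' : ℝ) ≤ radN n Q.R Q.r P k / 2 → ζ k x y' = 1
  /-- *"|(∂^η_xζ^{(k)})(b, y)| ≦ 1"*: Lipschitz `L^{−k}` per fine step -/
  ζ_lip : ∀ k, 1 ≤ k → k ≤ K → ∀ (x : HiggsLattice.Site P 0) (ν : Fin P.d) (y' : HiggsLattice.Site P k),
    |ζ k (x.shift ν) y' - ζ k x y'| ≤ ((P.L : ℝ) ^ k)⁻¹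
  /-- the `Λ₁`-region of level `k` (print: `Λ₋₁⁽ᵏ⁻¹⁾′`), where (2.55) holds -/
  L1 : (k : ℕ) → Finset (HiggsLattice.Site P k)
  /-- the `Λ₂`-region of level `k` (print: `Λ₂⁽ᵏ⁻¹⁾′`), over which (2.59)/(2.60) are used -/
  L2 : (k : ℕ) → Finset (HiggsLattice.Site P k)
  L2_sub : ∀ k, L2 k ⊆ L1 k
  /-- the range of `ζ^{(k)}` (+1) around `Bᵏ(Λ₂-region)` lies in the `Λ₁`-region, steps `1 ≤ k ≤ K` -/
  nbhd : ∀ k, 1 ≤ k → k ≤ K → ∀ x y', blockIter k x ∈ L2 k →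
    (HiggsLattice.Site.tdist (blockIter k x) y' : ℝ) ≤ radN n Q.R Q.r P k + 1 → y' ∈ L1 k
  /-- `Λ₅⁽ʲ⁾′ ⊆ Λ₂-region of level j + 1` (print: `Λ₅ ⊂ Λ₂`) -/
  lam_sub : ∀ j, j < K → B2Eq324NestedRegions.prime (T.lam j) ⊆ L2 (j + 1)
  /-- the `θ_{j+2}`-slice lies within `Bʲ⁺²(Λ₂-region of level j + 2)` -/
  slice_sub : ∀ j (z : HiggsLattice.Site P 0) (ν : Fin P.d),
    (θ (j + 2) z ≠ 0 ∨ θ (j + 2) (z.shift ν) ≠ 0) → blockIter (j + 2) z ∈ L2 (j + 2)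

namespace RMultiMRN

variable {n : ℕ} {Q : B2.Params} {Γ : MinConsts} {M : ℕ} {m2 : ℝ}

/-- **THE MINIMIZERS (3.3) OF THE INSTANCE**: `A^{(k),ε} = a_k(Lᵏε)^{−2}ζ^{(k)}G^ε_kQ*_kA_k` (r14's `cutMin`, vector-field case `N = d`).
[cite: Balaban1982Higgs2, (3.3) p.583] -/
def A (i : RMultiMRN n Q Γ M m2) (k : ℕ) : HiggsLattice.VecField i.P 0 :=
  ofSite (cutMin (zeroCharge i.P.d) Γ.μ0sq Q.a k (i.ζ k) (toSite (i.Ac k)))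

/-- Pointwise: `A^{(k),ε}(⟨x, μ⟩) = (cutMin … (toSite A_k))(x)_μ` (definitional). [cite: Balaban1982Higgs2, (3.3) p.583] -/
theorem A_apply (i : RMultiMRN n Q Γ M m2) (k : ℕ) (x : HiggsLattice.Site i.P 0) (μ : Fin i.P.d) :
    i.A k ⟨x, μ⟩ = cutMin (zeroCharge i.P.d) Γ.μ0sq Q.a k (i.ζ k) (toSite (i.Ac k)) x μ := rfl

/-- **The field `Ã^ε` of the instance**: (3.2) built from the cut-offs, `A₀` and the (3.3) minimizers. [cite: Balaban1982Higgs2, (3.2) p.583] -/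
def field (i : RMultiMRN n Q Γ M m2) : HiggsLattice.VecField i.P 0 := field32 i.θ i.A₀ i.A i.K

/-- **The map to the gen-10 carrier**: the same data, the minimizers SUPPLIED by (3.3). [cite: Balaban1982Higgs2, Prop. 3.1 p.589] -/
def toRMultiP (i : RMultiMRN n Q Γ M m2) (c₃ c₅ : ℝ) : RMultiP Q (Γ.toConsts c₃ c₅) m2 where
  P := i.P
  hL := i.hL
  hd := i.hd
  N := i.N
  K := i.K
  hK := i.hK
  hε₀ := i.hε₀
  T := i.T
  C := i.C
  hCe := i.hCe
  θ := i.θ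
  θ_nested := i.θ_nested
  θ_range := i.θ_range
  θ_one := i.θ_one
  θ_zero := i.θ_zero
  θ_above := i.θ_above
  θ_lip := i.θ_lip
  A₀ := i.A₀
  A := i.A
  Ac := i.Ac
  Φ := i.Φ

/-- The image has the same field `Ã^ε` (definitional). [cite: Balaban1982Higgs2, (3.2) p.583] -/
theorem toRMultiP_field (i : RMultiMRN n Q Γ M m2) (c₃ c₅ : ℝ) : (i.toRMultiP c₃ c₅).field = i.field := rfl

/-- **THE PRINTED RESTRICTIONS ON THE BLOCK FIELDS** (verbatim the body of `RMultiMK.restrictedM`): (2.55)₂ on the `Λ₁`-region, (2.55)₁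
(integrated) for `y` in the `Λ₂`-region and `y′` in the `Λ₁`-region, (2.17) on the `θ_{k+1}`-slices, (2.55)₄ on `Λ_k`; NO minimizer, NO
(2.59)/(2.60) assumed. [cite: Balaban1982Higgs2, Prop. 3.1 p.589, (3.21) p.588, (2.55) p.570, (2.17) p.560, (3.15) p.586] -/
def restrictedM (i : RMultiMRN n Q Γ M m2) : Prop :=
  (∀ k, 1 ≤ k → k ≤ i.K → ∀ y' ∈ i.L1 k, ‖toSite (i.Ac k) y'‖ ≤ Γ.thrA i.P.d (i.P.mesh k))
  ∧ (∀ k, 1 ≤ k → k ≤ i.K → ∀ y ∈ i.L2 k, ∀ y' ∈ i.L1 k,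
      ‖toSite (i.Ac k) y' - toSite (i.Ac k) y‖
        ≤ Γ.thrQ i.P.d (i.P.mesh k) * (Γ.r₁ + Γ.r₂ * (HiggsLattice.Site.tdist y y' : ℝ)))
  ∧ (∀ (j : Fin i.K), ∀ z ∈ pieceF i.T.regions j, ∀ μ ν : Fin i.P.d,
      (i.θ (j.val + 2) z ≠ 0 ∨ i.θ (j.val + 2) (z.shift ν) ≠ 0) →
      |i.Ac (j.val + 2) ⟨blockIter (j.val + 2) z, μ⟩ - i.Ac (j.val + 1) ⟨blockIter (j.val + 1) z, μ⟩|
        ≤ Γ.thr217M i.P.d (i.P.mesh (j.val + 1)))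
  ∧ (∀ (j : Fin i.K) (y : LSite i.T.regions j), ‖resL i.T.regions j i.Φ y‖ ≤ Γ.thrφM i.P.d (i.P.mesh (j.val + 1)))

/-- `s_k ≤ ε₀ ≤ 1` for `k ≤ K`. [cite: Balaban1982Higgs2, p.582] -/
theorem mesh_le_eps0 (hΓ : Γ.Valid) (i : RMultiMRN n Q Γ M m2) {k : ℕ} (hk : k ≤ i.K) : i.P.mesh k ≤ Γ.ε₀ ∧ i.P.mesh k ≤ 1 :=
  ⟨(mesh_le_mesh hk).trans i.hε₀, ((mesh_le_mesh hk).trans i.hε₀).trans hΓ.ε₀_le_one⟩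

/-- A fine point of `Bᵏ(Λ_k)` (`k = j + 1`) has its `k`-block label in `Λ₅⁽ʲ⁾′ ⊆ Λ₂-region of level k`. [cite: Balaban1982Higgs2, (3.22)–(3.24) p.588] -/
theorem blockIter_mem_L2_of_mem_pieceF (i : RMultiMRN n Q Γ M m2) (j : Fin i.K) {z : HiggsLattice.Site i.P 0}
    (hz : z ∈ pieceF i.T.regions j) : blockIter (j.val + 1) z ∈ i.L2 (j.val + 1) := by
  have h2 : blockIter (j.val + 1) z ∈ B2Eq324NestedRegions.prime (i.T.lam j.val) \ i.T.lam (j.val + 1) :=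
    (mem_pieceF_iff i.T.regions j z).mp hz
  exact i.lam_sub j.val j.isLt (Finset.mem_sdiff.mp h2).1

/-- **THE PRINTED RESTRICTIONS IMPLY THE GEN-10 RESTRICTIONS** for the image instance, given Lemma-2.3 constants `(δ, C₁, C₂)`, `r ≥ 1` and the
ENLARGED largeness `R ≥ (L/n)(2/δ + 2M + 2)` of (2.7) (so that `e^{−δρ_k^{(n)}/2} ≤ Lᵏε`, §1): all six conjuncts of `RMultiP.restricted` with
`c₃ = c3Of`, `c₅ = c5Of` — the proof of `RMultiMR.restricted_toRMultiP` with `lemma23_thresholds_rad` at the radius `ρ_k^{(n)}`.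
[cite: Balaban1982Higgs2, Prop. 3.1 p.589, Lemma 2.3 p.571, (2.97)–(2.98) p.577, (2.7) p.558] -/
theorem restricted_toRMultiP (hn : 1 ≤ n) (hΓ : Γ.Valid) (hQa : 0 < Q.a) {δ C₁ C₂ : ℝ}
    (pkg : Lemma23Bounds Q.d Q.L Q.a Γ.μ0sq Γ.ε₀ δ C₁ C₂) (hδ : 0 < δ) (hC₂ : 0 ≤ C₂)
    (hR : (Q.L : ℝ) / n * (2 / δ + 2 * (M : ℝ) + 2) ≤ Q.R) (hr : 1 ≤ Q.r) (i : RMultiMRN n Q Γ M m2) (hrM : i.restrictedM) :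
    (i.toRMultiP (Γ.c3Of Q.a Q.L C₁ C₂) (Γ.c5Of C₁ C₂)).restricted := by
  obtain ⟨hsup, hvar, h217, hΦ⟩ := hrM
  have hR' : (i.P.L : ℝ) / n * (2 / δ + 2 * (i.P.M : ℝ) + 2) ≤ Q.R := by rw [i.hL, i.hM]; exact hR
  have key : ∀ {k : ℕ}, 1 ≤ k → k ≤ i.K → ∀ (x : HiggsLattice.Site i.P 0), blockIter k x ∈ i.L2 k → ∀ μ ν : Fin i.P.d,
      |i.A k ⟨x, μ⟩ - i.Ac k ⟨blockIter k x, μ⟩|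
          ≤ thr259 (Γ.toConsts (Γ.c3Of Q.a Q.L C₁ C₂) (Γ.c5Of C₁ C₂)) i.P.d (i.P.mesh k)
      ∧ |i.A k ⟨x.shift ν, μ⟩ - i.A k ⟨x, μ⟩|
          ≤ thr260 (Γ.toConsts (Γ.c3Of Q.a Q.L C₁ C₂) (Γ.c5Of C₁ C₂)) i.P.d i.P.ε (i.P.mesh k) := by
    intro k hk1 hk x hx μ ν
    have hm := i.mesh_le_eps0 hΓ hk
    have hE : Real.exp (-(δ * (radN n Q.R Q.r i.P k / 2))) ≤ i.P.mesh k := exp_neg_delta_radN_le hn hk1 hm.2 hδ hR' hr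
    have hρ0 : 0 ≤ radN n Q.R Q.r i.P k := by
      have h := radN_ge_mul_u hn hk1 hm.2 (by positivity : (0 : ℝ) ≤ 2 / δ) hR' hr
      have hu : 1 ≤ 1 + Real.log (i.P.mesh k)⁻¹ := one_le_u (i.P.mesh_pos k) hm.2
      have : 0 ≤ 2 / δ * (1 + Real.log (i.P.mesh k)⁻¹) := by positivity
      linarith
    exact lemma23_thresholds_rad hΓ hQa pkg hC₂ i.S i.hd i.hL hk1 (hk.trans i.hK) hm.2 hm.1 hρ0 hE (i.ζ k) (i.ζ_abs k hk1 hk)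
      (i.ζ_supp k hk1 hk) (i.ζ_one k hk1 hk) (i.ζ_lip k hk1 hk) (i.L1 k) (i.L2 k) (i.L2_sub k) (i.nbhd k hk1 hk) (i.Ac k)
      (hsup k hk1 hk) (hvar k hk1 hk) x hx μ ν
  have hsl_le : ∀ (j : ℕ) (z : HiggsLattice.Site i.P 0) (ν : Fin i.P.d),
      (i.θ (j + 2) z ≠ 0 ∨ i.θ (j + 2) (z.shift ν) ≠ 0) → j + 2 ≤ i.K := by
    intro j z ν hsl
    by_contra hK
    have h0 := i.θ_above (j + 2) (by omega)
    rcases hsl with h | h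
    · exact h (h0 z)
    · exact h (h0 (z.shift ν))
  refine ⟨?_, ?_, ?_, ?_, ?_, ?_⟩
  · intro j z hz μ ν
    have hj : j.val < i.K := j.isLt
    exact (key (k := j.val + 1) (by omega) (by omega) z (i.blockIter_mem_L2_of_mem_pieceF j hz) μ ν).2
  · intro j z hz μ
    have hj : j.val < i.K := j.isLt
    exact (key (k := j.val + 1) (by omega) (by omega) z (i.blockIter_mem_L2_of_mem_pieceF j hz) μ μ).1
  · intro j z hz μ ν hsl
    have hsl' : i.θ (j.val + 2) z ≠ 0 ∨ i.θ (j.val + 2) (z.shift ν) ≠ 0 := hsl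
    exact (key (k := j.val + 2) (by omega) (hsl_le j.val z ν hsl') z (i.slice_sub j.val z ν hsl') μ ν).2
  · intro j z hz μ ν hsl
    have hsl' : i.θ (j.val + 2) z ≠ 0 ∨ i.θ (j.val + 2) (z.shift ν) ≠ 0 := hsl
    exact (key (k := j.val + 2) (by omega) (hsl_le j.val z ν hsl') z (i.slice_sub j.val z ν hsl') μ ν).1
  · intro j z hz μ ν hsl
    have hsl' : i.θ (j.val + 2) z ≠ 0 ∨ i.θ (j.val + 2) (z.shift ν) ≠ 0 := hsl
    have hz' : z ∈ pieceF i.T.regions j := hz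
    rw [MinConsts.thr217_toConsts]
    exact h217 j z hz' μ ν hsl'
  · intro j y
    rw [MinConsts.thrφ_toConsts]
    exact hΦ j y

end RMultiMRN

/-! ## §3 The families and Proposition 3.1 / (3.29) for them -/

/-- **THE FAMILY OF `B2.P31Setting` WITH THE (3.3) MINIMIZERS, THE (2.55) RESTRICTIONS AND THE `n`-COLLAR RADIUS**: `restricted := restrictedM`;
all other fields as in gen 10's `printedP31Fam` for the image instance. [cite: Balaban1982Higgs2, Prop. 3.1 (3.26)–(3.28) p.589] -/
def minP31FamN (n : ℕ) (Q : B2.Params) (Γ : MinConsts) (M : ℕ) (m2 : ℝ) (i : RMultiMRN n Q Γ M m2) : B2.P31Setting :=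
  { printedP31Fam Q (Γ.toConsts 0 0) m2 (i.toRMultiP 0 0) with restricted := i.restrictedM }

/-- The numeric fields of `minP31FamN` are those of `printedP31Fam` at the image instance, for ANY `c₃`, `c₅` (definitional).
[cite: Balaban1982Higgs2, Prop. 3.1 p.589] -/
theorem minP31FamN_eq (n : ℕ) (Q : B2.Params) (Γ : MinConsts) (M : ℕ) (m2 : ℝ) (i : RMultiMRN n Q Γ M m2) (c₃ c₅ : ℝ) :
    minP31FamN n Q Γ M m2 i = { printedP31Fam Q (Γ.toConsts c₃ c₅) m2 (i.toRMultiP c₃ c₅) with restricted := i.restrictedM } := rfl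

/-- **THE PER-SCALE (3.29) FAMILY** (`restricted := restrictedM`). [cite: Balaban1982Higgs2, (3.29) p.590] -/
def min329FamN (n : ℕ) (Q : B2.Params) (Γ : MinConsts) (M : ℕ) (m2 : ℝ) (ij : Σ i : RMultiMRN n Q Γ M m2, Fin i.K) : B2.I329Setting :=
  { printed329Fam Q (Γ.toConsts 0 0) m2 ⟨ij.1.toRMultiP 0 0, ij.2⟩ with restricted := ij.1.restrictedM }

/-- **PROPOSITION 3.1 (3.26) FOR THE FAMILY WITH THE PRINTED MINIMIZERS, THE PRINTED RESTRICTIONS AND THE `n`-COLLAR CUT-OFF RADIUS**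
(`n ≥ 1`).  For `d ∈ {2, 3}`, odd `L > 1`, the large-block factor `M`, `a > 0`, `μ₀² > 0`, `0 < ε₀ ≤ 1` there are `R₀ > 0` (*"R > R₀"* of
(2.7); here `R₀ = (L/n)(2/δ + 2M + 2)`) and O(1)'s `c₃, c₅ ≥ 0` such that for every `Q` with `Q.d = d`, `Q.L = L`, `Q.a = a`, `Q.R ≥ R₀`, `Q.r ≥ 1`,
`Q.κ₀ < 2 − d/2`, every valid `Γ` with `Γ.μ0sq = μ₀²`, `Γ.ε₀ = ε₀` and small coupling (`SmallEps d L (Γ.toConsts c₃ c₅)`), and every `m² > 0`, the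
cell's typed `B2.Prop31Printed Q` HOLDS on `minP31FamN Q Γ M m²` (both conjuncts). [cite: Balaban1982Higgs2, Prop. 3.1 (3.26) p.589, Lemma 2.3 p.571, (3.3) p.583, (2.44) p.566, (2.7) p.558] -/
theorem prop31Printed_minimizersN (n : ℕ) (hn : 1 ≤ n) (d L M : ℕ) (hd2 : 2 ≤ d) (hd3 : d ≤ 3) (hL : Odd L ∧ 1 < L) {a : ℝ} (ha : 0 < a)
    {μ0sq : ℝ} (hμ : 0 < μ0sq) (ε₀ : ℝ) (Γ : MinConsts) (hΓ : Γ.Valid) (hΓμ : Γ.μ0sq = μ0sq) (hΓε : Γ.ε₀ = ε₀) :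
    ∃ R₀ c₃ c₅ : ℝ, 0 < R₀ ∧ 0 ≤ c₃ ∧ 0 ≤ c₅ ∧
      ∀ (Q : B2.Params), Q.d = d → Q.L = L → Q.a = a → R₀ ≤ Q.R → 1 ≤ Q.r → Q.κ₀ < 2 - (d : ℝ) / 2 →
        SmallEps d L (Γ.toConsts c₃ c₅) → ∀ {m2 : ℝ}, 0 < m2 → B2.Prop31Printed Q (minP31FamN n Q Γ M m2) := by
  obtain ⟨δ, C₁, C₂, hδ, hC₁, hC₂, pkg⟩ := exists_lemma23Bounds d L (by omega) hL ha hμ ε₀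
  have hLpos : (0 : ℝ) < (L : ℝ) := by exact_mod_cast (lt_trans Nat.zero_lt_one hL.2)
  have hnpos : (0 : ℝ) < (n : ℝ) := by exact_mod_cast (lt_of_lt_of_le Nat.zero_lt_one hn)
  refine ⟨(L : ℝ) / n * (2 / δ + 2 * (M : ℝ) + 2), Γ.c3Of a L C₁ C₂, Γ.c5Of C₁ C₂, by positivity,
    MinConsts.c3Of_nonneg hΓ ha hL.2 hC₁.le hC₂.le, MinConsts.c5Of_nonneg hΓ hC₁.le hC₂.le, ?_⟩
  intro Q hQd hQL hQa hR hRr hκ hsm m2 hm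
  subst hQd hQL hQa hΓμ hΓε
  have hΓ'v : (Γ.toConsts (Γ.c3Of Q.a Q.L C₁ C₂) (Γ.c5Of C₁ C₂)).Valid :=
    MinConsts.toConsts_valid hΓ (MinConsts.c3Of_nonneg hΓ ha hL.2 hC₁.le hC₂.le) (MinConsts.c5Of_nonneg hΓ hC₁.le hC₂.le)
  obtain ⟨γ₀, Cc, hγ, hCc, h1, h2⟩ := prop31Printed_thresholds Q hL.2 ha hd2 hd3 hκ _ hΓ'v hsm hm
  refine ⟨γ₀, Cc, hγ, hCc, fun i hri => ?_, fun i hz => ?_⟩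
  · exact h1 (i.toRMultiP (Γ.c3Of Q.a Q.L C₁ C₂) (Γ.c5Of C₁ C₂))
      (RMultiMRN.restricted_toRMultiP hn hΓ ha pkg hδ hC₂.le hR hRr i hri)
  · exact h2 (i.toRMultiP (Γ.c3Of Q.a Q.L C₁ C₂) (Γ.c5Of C₁ C₂)) hz

/-- **THE CELL'S TYPED (3.29) FOR THE PER-SCALE `n`-COLLAR FAMILY** (same constants; `m² ≥ 0`; `n ≥ 1`). [cite: Balaban1982Higgs2, (3.29) p.590] -/
theorem ineq329Printed_minimizersN (n : ℕ) (hn : 1 ≤ n) (d L M : ℕ) (hd2 : 2 ≤ d) (hd3 : d ≤ 3) (hL : Odd L ∧ 1 < L) {a : ℝ} (ha : 0 < a)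
    {μ0sq : ℝ} (hμ : 0 < μ0sq) (ε₀ : ℝ) (Γ : MinConsts) (hΓ : Γ.Valid) (hΓμ : Γ.μ0sq = μ0sq) (hΓε : Γ.ε₀ = ε₀) :
    ∃ R₀ c₃ c₅ : ℝ, 0 < R₀ ∧ 0 ≤ c₃ ∧ 0 ≤ c₅ ∧
      ∀ (Q : B2.Params), Q.d = d → Q.L = L → Q.a = a → R₀ ≤ Q.R → 1 ≤ Q.r → Q.κ₀ < 2 - (d : ℝ) / 2 →
        SmallEps d L (Γ.toConsts c₃ c₅) → ∀ {m2 : ℝ}, 0 ≤ m2 → B2.Ineq329Printed Q.κ₀ (min329FamN n Q Γ M m2) := by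
  obtain ⟨δ, C₁, C₂, hδ, hC₁, hC₂, pkg⟩ := exists_lemma23Bounds d L (by omega) hL ha hμ ε₀
  have hLpos : (0 : ℝ) < (L : ℝ) := by exact_mod_cast (lt_trans Nat.zero_lt_one hL.2)
  have hnpos : (0 : ℝ) < (n : ℝ) := by exact_mod_cast (lt_of_lt_of_le Nat.zero_lt_one hn)
  refine ⟨(L : ℝ) / n * (2 / δ + 2 * (M : ℝ) + 2), Γ.c3Of a L C₁ C₂, Γ.c5Of C₁ C₂, by positivity,
    MinConsts.c3Of_nonneg hΓ ha hL.2 hC₁.le hC₂.le, MinConsts.c5Of_nonneg hΓ hC₁.le hC₂.le, ?_⟩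
  intro Q hQd hQL hQa hR hRr hκ hsm m2 hm
  subst hQd hQL hQa hΓμ hΓε
  have hΓ'v : (Γ.toConsts (Γ.c3Of Q.a Q.L C₁ C₂) (Γ.c5Of C₁ C₂)).Valid :=
    MinConsts.toConsts_valid hΓ (MinConsts.c3Of_nonneg hΓ ha hL.2 hC₁.le hC₂.le) (MinConsts.c5Of_nonneg hΓ hC₁.le hC₂.le)
  obtain ⟨γ₀, Cc, hγ, hCc, h1⟩ := ineq329Printed_thresholds Q hL.2 ha hd2 hd3 hκ _ hΓ'v hsm hm
  refine ⟨γ₀, Cc, hγ, hCc, fun ij hri => ?_⟩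
  obtain ⟨i, j⟩ := ij
  exact h1 ⟨i.toRMultiP (Γ.c3Of Q.a Q.L C₁ C₂) (Γ.c5Of C₁ C₂), j⟩
    (RMultiMRN.restricted_toRMultiP hn hΓ ha pkg hδ hC₂.le hR hRr i hri)

/-! ## §4 The constructor from the large-field data, Lemma 2.3 read over `(Λ_{n−1})′` -/

section Constructor

/-- **The regions tower of the instance** (the typer's `towerOf`, radii `towerRad`; nonnegative by `R ≥ (L/n)(2M + 8)`, `r ≥ 1`).
[cite: Balaban1982Higgs2, (2.43) p.566, (3.22)–(3.23) p.588] -/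
def dataTowerN (n : ℕ) (hn : 1 ≤ n) (Q : B2.Params) (P : HiggsLattice.Params) (hR : (P.L : ℝ) / n * (2 * (P.M : ℝ) + 8) ≤ Q.R)
    (hr : 1 ≤ Q.r) (bad : (j : ℕ) → Set (HiggsLattice.Site P j)) (K : ℕ) : Tower P K :=
  towerOf bad (towerRad Q P) (towerRad_nonneg (R_pos_ofN hn hR).le (zero_le_one.trans hr) P) K

/-- **The Lemma-2.3 domains of the instance**: at level `k = l + 1`, `(Λ_{n−1}^{(l)})′`; `∅` at level `0`. [cite: Balaban1982Higgs2, Lemma 2.3 p.571, (2.8) p.558] -/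
def L2OfN (n : ℕ) (Q : B2.Params) (P : HiggsLattice.Params) (bad : (j : ℕ) → Set (HiggsLattice.Site P j)) :
    (k : ℕ) → Finset (HiggsLattice.Site P k)
  | 0 => ∅
  | l + 1 => prime (towerRegion bad (towerRad Q P) l (n - 1))

/-- **THE REMAINING DATA** (as p319405's `RegionsData`, with `1 ≤ n ≤ 3`, the largeness `R ≥ (L/n)(2M + 8)`, and the `θ`-slice inclusion over
`(Λ_{n−1})′`): torus of the sub-family, steps, large-field points `bad j`, charge data, cut-offs `θ_k` with their printed properties relative to the
constructed tower, `A₀`, `A_k`, `Φ`. [cite: Balaban1982Higgs2, Prop. 3.1 p.589, (2.43) p.566, p.567, (3.2) p.583, (3.24) p.588] -/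
structure RegionsDataN (n : ℕ) (Q : B2.Params) (Γ : MinConsts) (M : ℕ) (m2 : ℝ) where
  hn1 : 1 ≤ n
  hn3 : n ≤ 3
  P : HiggsLattice.Params
  hL : P.L = Q.L
  hd : P.d = Q.d
  hM : P.M = M
  S : Shape P
  N : ℕ
  K : ℕ
  hK : K ≤ P.K
  hε₀ : P.mesh K ≤ Γ.ε₀
  hmesh1 : P.mesh K ≤ 1
  /-- *"R > R₀"* of (2.7), explicit: `R ≥ (L/n)(2M + 8)` -/
  hR : (P.L : ℝ) / n * (2 * (P.M : ℝ) + 8) ≤ Q.R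
  /-- *"r > 1"* of (2.7) (here `≥ 1`) -/
  hr : 1 ≤ Q.r
  bad : (j : ℕ) → Set (HiggsLattice.Site P j)
  C : ChargeData N
  hCe : C.e = Γ.e
  θ : ℕ → HiggsLattice.Site P 0 → ℝ
  θ_nested : Nested θ
  θ_range : ∀ m (z : HiggsLattice.Site P 0), 0 ≤ θ m z ∧ θ m z ≤ 1
  θ_one : ∀ k, 1 ≤ k → k ≤ K → ∀ z : HiggsLattice.Site P 0,
    (dataTowerN n hn1 Q P hR hr bad K).lamAt (k - 1) z → θ k z = 1 ∧ ∀ ν, θ k (z.shift ν) = 1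
  θ_zero : ∀ k, k + 2 ≤ K → ∀ z : HiggsLattice.Site P 0, (θ (k + 2) z ≠ 0 ∨ ∃ ν, θ (k + 2) (z.shift ν) ≠ 0) →
    (dataTowerN n hn1 Q P hR hr bad K).lamAt k z
  θ_above : ∀ m, K < m → ∀ z : HiggsLattice.Site P 0, θ m z = 0
  θ_lip : ∀ k (z : HiggsLattice.Site P 0) (ν : Fin P.d), |θ (k + 1) (z.shift ν) - θ (k + 1) z| ≤ Γ.cθ * ((P.L : ℝ) ^ k)⁻¹
  A₀ : HiggsLattice.VecField P 0
  Ac : (k : ℕ) → HiggsLattice.VecField P k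
  Φ : Cfg (dataTowerN n hn1 Q P hR hr bad K).regions N
  /-- the `θ_{j+2}`-slice lies within `Bʲ⁺²((Λ_{n−1}^{(j+1)})′)` (for `n ≤ 2` the printed `θ` of p. 567 qualifies) -/
  slice_sub : ∀ j (z : HiggsLattice.Site P 0) (ν : Fin P.d),
    (θ (j + 2) z ≠ 0 ∨ θ (j + 2) (z.shift ν) ≠ 0) → blockIter (j + 2) z ∈ L2OfN n Q P bad (j + 2)

namespace RegionsDataN

variable {n : ℕ} {Q : B2.Params} {Γ : MinConsts} {M : ℕ} {m2 : ℝ}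

/-- `R ≥ 0`. [cite: Balaban1982Higgs2, (2.7) p.558] -/
theorem hR0 (D : RegionsDataN n Q Γ M m2) : 0 ≤ Q.R := (R_pos_ofN D.hn1 D.hR).le

/-- `r ≥ 0`. [cite: Balaban1982Higgs2, (2.7) p.558] -/
theorem hr0 (D : RegionsDataN n Q Γ M m2) : 0 ≤ Q.r := zero_le_one.trans D.hr

/-- The tower of the data (abbreviation). [cite: Balaban1982Higgs2, (3.22) p.588] -/
def tower (D : RegionsDataN n Q Γ M m2) : Tower D.P D.K := dataTowerN n D.hn1 Q D.P D.hR D.hr D.bad D.K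

/-- `s_k ≤ 1` for `k ≤ K`. [cite: Balaban1982Higgs2, p.582] -/
theorem mesh_le_one (D : RegionsDataN n Q Γ M m2) {k : ℕ} (hk : k ≤ D.K) : D.P.mesh k ≤ 1 := (mesh_le_mesh hk).trans D.hmesh1

/-- `n ≤ 2ML + 1` (from `n ≤ 3`, `M ≥ 1`, `L ≥ 1`). [cite: Balaban1982Higgs1, (1.2) p.604] -/
theorem n_le (D : RegionsDataN n Q Γ M m2) : (n : ℝ) ≤ 2 * (D.P.M : ℝ) * (D.P.L : ℝ) + 1 := by
  have h3 : (n : ℝ) ≤ 3 := by exact_mod_cast D.hn3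
  have hL : (1 : ℝ) ≤ (D.P.L : ℝ) := by exact_mod_cast D.P.hL
  have hM : (1 : ℝ) ≤ (D.P.M : ℝ) := by exact_mod_cast D.P.hM
  nlinarith

/-- **THE INSTANCE BUILT FROM THE DATA**: regions = the constructed tower, `L1 := (near Λ₀^{(l)} r)′`, `L2 := (Λ_{n−1}^{(l)})′`, `ζ^{(k)} := zeta244 k ρ_k^{(n)}`;
`ζ_*`, `L2_sub`, `nbhd` (`nbhd_radN`), `lam_sub` PROVED. [cite: Balaban1982Higgs2, Prop. 3.1 p.589, (2.44) p.566, (2.8) p.558, Lemma 2.3 p.571] -/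
def toRMultiMRN (D : RegionsDataN n Q Γ M m2) : RMultiMRN n Q Γ M m2 where
  P := D.P
  hL := D.hL
  hd := D.hd
  hM := D.hM
  S := D.S
  N := D.N
  K := D.K
  hK := D.hK
  hε₀ := D.hε₀
  T := D.tower
  C := D.C
  hCe := D.hCe
  θ := D.θ
  θ_nested := D.θ_nested
  θ_range := D.θ_range
  θ_one := D.θ_one
  θ_zero := D.θ_zero
  θ_above := D.θ_above
  θ_lip := D.θ_lip
  A₀ := D.A₀
  Ac := D.Ac
  Φ := D.Φ
  ζ k := zeta244 D.P k (radN n Q.R Q.r D.P k)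
  ζ_abs k _ _ x y' := abs_zeta244_le_one _ x y'
  ζ_supp k _ hk x y' h := zeta244_supp (hk.trans D.hK) h
  ζ_one k hk1 hk x y' h := by
    have h6 : 6 ≤ radN n Q.R Q.r D.P k := six_le_radN D.hn1 hk1 (D.mesh_le_one hk) D.hR D.hr
    exact zeta244_eq_one (hk.trans D.hK) (by linarith) h
  ζ_lip k _ _ x ν y' := zeta244_lip _ x ν y'
  L1 := L1Of Q D.P D.bad
  L2 := L2OfN n Q D.P D.bad
  L2_sub k := by
    cases k with
    | zero => exact Finset.Subset.refl _
    | succ l =>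
        have hpos : 0 < towerRad Q D.P l := lt_of_lt_of_le (R_pos_ofN D.hn1 D.hR) (le_towerRad D.hR0 D.hr0 D.P l)
        exact prime_mono ((towerRegion_antitone hpos.le (Nat.zero_le (n - 1))).trans (subset_near hpos))
  nbhd k hk1 hk x y' hx hd := by
    obtain ⟨l, rfl⟩ : ∃ l, k = l + 1 := ⟨k - 1, by omega⟩
    have hl1 : D.P.mesh l ≤ 1 := D.mesh_le_one ((Nat.le_succ l).trans hk)
    have hpos : 0 < B2.rFn Q.R Q.r (D.P.mesh l) := rFn_pos_ofN D.hn1 D.hR D.hr0 (D.P.mesh_pos l) hl1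
    exact nbhd_radN n D.hn1 D.n_le (hk.trans D.hK) (towerRad_eq hl1) hpos x y' hx hd
  lam_sub j hj := by
    have h : D.tower.lam j = towerRegion D.bad (towerRad Q D.P) j 5 :=
      towerOf_lam_of_lt (bad := D.bad) (hr := towerRad_nonneg D.hR0 D.hr0 D.P) hj
    rw [h]
    have hn3 := D.hn3
    exact prime_mono (towerRegion_antitone (towerRad_nonneg D.hR0 D.hr0 D.P j) (by omega))
  slice_sub := D.slice_sub

/-- The instance lives on the data's torus (definitional). [cite: Balaban1982Higgs1, (1.2) p.604] -/
theorem toRMultiMRN_P (D : RegionsDataN n Q Γ M m2) : D.toRMultiMRN.P = D.P := rfl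

/-- Its number of steps (definitional). [cite: Balaban1982Higgs2, p.582] -/
theorem toRMultiMRN_K (D : RegionsDataN n Q Γ M m2) : D.toRMultiMRN.K = D.K := rfl

/-- Its `Λ₂`-region at level `l + 1` is `(Λ_{n−1}^{(l)})′` (definitional). [cite: Balaban1982Higgs2, Lemma 2.3 p.571] -/
theorem toRMultiMRN_L2_succ (D : RegionsDataN n Q Γ M m2) (l : ℕ) :
    D.toRMultiMRN.L2 (l + 1) = prime (towerRegion D.bad (towerRad Q D.P) l (n - 1)) := rfl

/-- Its `Λ₁`-region at level `l + 1` is `(near Λ₀^{(l)} r(Lˡε))′` (definitional). [cite: Balaban1982Higgs2, (2.55) p.570] -/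
theorem toRMultiMRN_L1_succ (D : RegionsDataN n Q Γ M m2) (l : ℕ) :
    D.toRMultiMRN.L1 (l + 1) = prime (near (towerRegion D.bad (towerRad Q D.P) l 0) (towerRad Q D.P l)) := rfl

end RegionsDataN

end Constructor

/-! ## §5 Non-vacuity of the data at `K = 1`, for every large-field datum -/

section NonVacuity

variable {n : ℕ} {Q : B2.Params} {Γ : MinConsts} {M : ℕ} {m2 : ℝ}

/-- **A ONE-STEP DATUM FOR EVERY TORUS AND EVERY LARGE-FIELD CONFIGURATION** (`1 ≤ n ≤ 3`): `K = 1`, `θ₁ ≡ 1`, `A₀ = 0`, `A_k ≡ v`, `Φ = 0`, any `bad`.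
[cite: Balaban1982Higgs2, Prop. 3.1 p.589, (3.2) p.583, p.567, (2.43) p.566] -/
def regionsDataWN (hn1 : 1 ≤ n) (hn3 : n ≤ 3) (hΓ : Γ.Valid) (hR : (Q.L : ℝ) / n * (2 * (M : ℝ) + 8) ≤ Q.R) (hr : 1 ≤ Q.r)
    (P : HiggsLattice.Params) (S : Shape P) (hPL : P.L = Q.L) (hPd : P.d = Q.d) (hPM : P.M = M) (hK1 : 1 ≤ P.K)
    (hε₀ : P.mesh 1 ≤ Γ.ε₀) (bad : (j : ℕ) → Set (HiggsLattice.Site P j)) (v : EuclideanSpace ℝ (Fin P.d)) :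
    RegionsDataN n Q Γ M m2 where
  hn1 := hn1
  hn3 := hn3
  P := P
  hL := hPL
  hd := hPd
  hM := hPM
  S := S
  N := 1
  K := 1
  hK := hK1
  hε₀ := hε₀
  hmesh1 := hε₀.trans hΓ.ε₀_le_one
  hR := by rw [hPL, hPM]; exact hR
  hr := hr
  bad := bad
  C := chargeW Γ.e
  hCe := rfl
  θ := thetaW P
  θ_nested := nested_thetaW
  θ_range m z := by
    by_cases hm : m = 1
    · subst hm; rw [thetaW_one]; norm_num
    · rw [thetaW_of_ne hm]; norm_num
  θ_one k hk1 hkK z _ := by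
    obtain rfl : k = 1 := by omega
    exact ⟨thetaW_one z, fun ν => thetaW_one _⟩
  θ_zero k hk z _ := by omega
  θ_above m hm z := thetaW_of_ne (by omega) z
  θ_lip k z ν := by
    have h0 : thetaW P (k + 1) (z.shift ν) - thetaW P (k + 1) z = 0 := by
      by_cases hk : k + 1 = 1
      · rw [hk, thetaW_one, thetaW_one, sub_self]
      · rw [thetaW_of_ne hk, thetaW_of_ne hk, sub_self]
    rw [h0, abs_zero]
    exact mul_nonneg hΓ.cθ_nonneg (inv_nonneg.2 (pow_nonneg (Nat.cast_nonneg _) _))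
  A₀ := 0
  Ac k := ofSite (fun _ : HiggsLattice.Site P k => v)
  Φ := 0
  slice_sub j z ν hsl := by
    exfalso
    have hj : j + 2 ≠ 1 := by omega
    rcases hsl with h | h
    · exact h (thetaW_of_ne hj z)
    · exact h (thetaW_of_ne (P := P) hj (z.shift ν))

variable (hn1 : 1 ≤ n) (hn3 : n ≤ 3) (hΓ : Γ.Valid) (hR : (Q.L : ℝ) / n * (2 * (M : ℝ) + 8) ≤ Q.R) (hr : 1 ≤ Q.r)
  (P : HiggsLattice.Params) (S : Shape P) (hPL : P.L = Q.L) (hPd : P.d = Q.d) (hPM : P.M = M) (hK1 : 1 ≤ P.K)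
  (hε₀ : P.mesh 1 ≤ Γ.ε₀) (bad : (j : ℕ) → Set (HiggsLattice.Site P j)) (v : EuclideanSpace ℝ (Fin P.d))

/-- **THE ONE-STEP DATUM IS RESTRICTED** once `‖v‖ ≤ c_{A1}(Lε)^{−d/2}p(Lε)` — for every `bad`. [cite: Balaban1982Higgs2, Prop. 3.1 p.589, (2.55) p.570, (2.17) p.560, (3.15) p.586] -/
theorem regionsDataWN_restrictedM (hv : ‖v‖ ≤ Γ.thrA P.d (P.mesh 1)) :
    (regionsDataWN (m2 := m2) hn1 hn3 hΓ hR hr P S hPL hPd hPM hK1 hε₀ bad v).toRMultiMRN.restrictedM := by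
  have hs1 : P.mesh 1 ≤ 1 := hε₀.trans hΓ.ε₀_le_one
  refine ⟨?_, ?_, ?_, ?_⟩
  · intro k hk1 hk y' _
    change k ≤ 1 at hk
    obtain rfl : k = 1 := le_antisymm hk hk1
    show ‖toSite (ofSite fun _ : HiggsLattice.Site P 1 => v) y'‖ ≤ Γ.thrA P.d (P.mesh 1)
    rw [toSite_ofSite]
    exact hv
  · intro k hk1 hk y _ y' _
    change k ≤ 1 at hk
    obtain rfl : k = 1 := le_antisymm hk hk1
    show ‖toSite (ofSite fun _ : HiggsLattice.Site P 1 => v) y' - toSite (ofSite fun _ : HiggsLattice.Site P 1 => v) y‖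
      ≤ Γ.thrQ P.d (P.mesh 1) * (Γ.r₁ + Γ.r₂ * (HiggsLattice.Site.tdist y y' : ℝ))
    rw [toSite_ofSite, sub_self, norm_zero]
    have h1 := thrQ_nonneg hΓ (P.mesh_pos 1) hs1 P.d
    have h2 := hΓ.r₁_nonneg
    have h3 := hΓ.r₂_nonneg
    positivity
  · intro j z _ μ ν hsl
    exfalso
    have hj : j.val + 2 ≠ 1 := by omega
    rcases hsl with h | h
    · exact h (thetaW_of_ne hj z)
    · exact h (thetaW_of_ne (P := P) hj (z.shift ν))
  · intro j y
    show ‖(0 : V 1)‖ ≤ _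
    rw [norm_zero]
    have hj : j.val = 0 := by
      have h := j.isLt
      change j.val < 1 at h
      omega
    have hsj : 0 < P.mesh (j.val + 1) ∧ P.mesh (j.val + 1) ≤ 1 := by rw [hj]; exact ⟨P.mesh_pos 1, hs1⟩
    unfold MinConsts.thrφM
    have hp : 0 ≤ B2.pFn Γ.b₀ Γ.p (P.mesh (j.val + 1)) :=
      pFn_nonneg' (Γ := Γ.toConsts 0 0) (MinConsts.toConsts_valid hΓ le_rfl le_rfl) hsj.1 hsj.2
    have := hΓ.cφ_nonneg
    have := hΓ.lam_pos
    have : 0 ≤ Γ.lam ^ (-(1 / 4 : ℝ)) := Real.rpow_nonneg hΓ.lam_pos.le _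
    have : 0 ≤ P.mesh (j.val + 1) ^ (-(P.d : ℝ) / 4) := Real.rpow_nonneg hsj.1.le _
    positivity

/-! ## §6 The field of the `K = 1` datum over `Λ_{n−1}^{(0)}` is not zero -/

/-- **The field of the datum IS its (3.3) minimizer at the radius `ρ^{(n)}`** (`θ₁ ≡ 1`: `field32_eq_top`). [cite: Balaban1982Higgs2, (3.2)–(3.3) p.583] -/
theorem regionsDataWN_field_apply (b : HiggsLattice.PBond P 0) :
    (regionsDataWN (m2 := m2) hn1 hn3 hΓ hR hr P S hPL hPd hPM hK1 hε₀ bad v).toRMultiMRN.field b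
      = cutMin (zeroCharge P.d) Γ.μ0sq Q.a 1 (zeta244 P 1 (radN n Q.R Q.r P 1)) (fun _ => v) b.src b.dir := by
  show field32 (thetaW P) 0 (regionsDataWN (m2 := m2) hn1 hn3 hΓ hR hr P S hPL hPd hPM hK1 hε₀ bad v).toRMultiMRN.A 1 b = _
  rw [field32_eq_top (thetaW P) 0 _ nested_thetaW le_rfl b (thetaW_one _)]
  show ofSite (cutMin (zeroCharge P.d) Γ.μ0sq Q.a 1 (zeta244 P 1 (radN n Q.R Q.r P 1))
    (toSite (ofSite fun _ : HiggsLattice.Site P 1 => v))) b = _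
  rw [toSite_ofSite]
  rfl

/-- **THE FIELD OF THE DATUM IS NOT ZERO** whenever some fine point lies over `(Λ_{n−1}^{(0)})′`, `v ≠ 0`, `κ·Lε < 1` and `R ≥ (L/n)(2/δ + 2M + 2)`
(p320224's `norm_cutMin_const_sub_lt_rad` fed with the constructed instance's own `ζ`-clauses, `L2_sub`, `nbhd`).
[cite: Balaban1982Higgs2, Prop. 3.1 p.589, (3.2)–(3.3) p.583, Lemma 2.3 p.571, (2.8) p.558] -/
theorem regionsDataWN_field_ne_zero (hQa : 0 < Q.a) {δ C₁ C₂ : ℝ} (pkg : Lemma23Bounds Q.d Q.L Q.a Γ.μ0sq Γ.ε₀ δ C₁ C₂) (hδ : 0 < δ)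
    (hC₂ : 0 ≤ C₂) (hRδ : (Q.L : ℝ) / n * (2 / δ + 2 * (M : ℝ) + 2) ≤ Q.R) (hsmall : kappaW Q.a Q.L Γ.μ0sq C₂ * P.mesh 1 < 1)
    (hv : v ≠ 0) {x : HiggsLattice.Site P 0} (hx : blockIter 1 x ∈ prime (towerRegion bad (towerRad Q P) 0 (n - 1))) :
    (regionsDataWN (m2 := m2) hn1 hn3 hΓ hR hr P S hPL hPd hPM hK1 hε₀ bad v).toRMultiMRN.field ≠ 0 := by
  intro h0
  set D := regionsDataWN (m2 := m2) hn1 hn3 hΓ hR hr P S hPL hPd hPM hK1 hε₀ bad v with hD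
  have hs1 : P.mesh 1 ≤ 1 := hε₀.trans hΓ.ε₀_le_one
  have hRδ' : (P.L : ℝ) / n * (2 / δ + 2 * (P.M : ℝ) + 2) ≤ Q.R := by rw [hPL, hPM]; exact hRδ
  have hR8' : (P.L : ℝ) / n * (2 * (P.M : ℝ) + 8) ≤ Q.R := by rw [hPL, hPM]; exact hR
  have hE : Real.exp (-(δ * (radN n Q.R Q.r P 1 / 2))) ≤ P.mesh 1 := exp_neg_delta_radN_le hn1 le_rfl hs1 hδ hRδ' hr
  have hρ0 : 0 ≤ radN n Q.R Q.r P 1 := by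
    have h6 : 6 ≤ radN n Q.R Q.r P 1 := six_le_radN hn1 le_rfl hs1 hR8' hr
    linarith
  have hx' : blockIter 1 x ∈ D.toRMultiMRN.L2 1 := hx
  have hlt := norm_cutMin_const_sub_lt_rad hQa hΓ.μ0sq_pos pkg hC₂ S hPd hPL (k := 1) le_rfl hK1 hε₀ hs1 hρ0 hE
    (zeta244 P 1 (radN n Q.R Q.r P 1)) (D.toRMultiMRN.ζ_abs 1 le_rfl le_rfl) (D.toRMultiMRN.ζ_supp 1 le_rfl le_rfl)
    (D.toRMultiMRN.ζ_one 1 le_rfl le_rfl) (D.toRMultiMRN.ζ_lip 1 le_rfl le_rfl) (D.toRMultiMRN.L1 1) (D.toRMultiMRN.L2 1)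
    (D.toRMultiMRN.L2_sub 1) (D.toRMultiMRN.nbhd 1 le_rfl le_rfl) hsmall hv x hx'
  have hne : cutMin (zeroCharge P.d) Γ.μ0sq Q.a 1 (zeta244 P 1 (radN n Q.R Q.r P 1)) (fun _ => v) x ≠ 0 := by
    intro hz
    rw [hz, zero_sub, norm_neg] at hlt
    exact lt_irrefl _ hlt
  apply hne
  ext μ
  have hb := congrFun h0 ⟨x, μ⟩
  rw [regionsDataWN_field_apply] at hb
  rw [hb]
  rfl

end NonVacuity

end Literature.MathematicalPhysics.QuantumFieldTheory.Balaban1983to89.B2Prop31MinimizerRegionsN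

end
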